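import Summits.KontsevichZagierPeriods.KontsevichZagierPeriods.Theorems.RootDecompRationalCubeDichotomySimpleBranchHalfWinding

/-!
# Route RootDecompRationalCubeDichotomy — item 27842 `PiRationalisationSimpleBranch` PROVED, part 2/11 (`RootDecompRationalCubeDichotomySimpleBranchPoleBox`)

Theorems-split (≤ 400 lines each, sequential imports) of the decomp-kz lens-2 gen-4 file
`run/shared/lean/pub/decomp-kz/decomp-kz-lens-2/g4/PiRationalisationSimpleBranch27842.lean` (2963 lines; lens farm rc 0, writer re-check
rc 0 audit proof-of-item closed:true, critic g2 by-name probe std axioms, 2026-08-30T05:27:57Z/06:02:52Z). The rung: for simple-branch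
Nash data (`F(x,g) = 0`, `∂_z F(x,g) ≠ 0` on the closed cube) `[π]^K·[s] ∈ relations ⊔ ⟨rational closed-cube sector⟩` for all `K ≥ 1` —
root isolation on rational sub-boxes, the Green band move (planar Stokes inside the four moves), the half winding number ≡ 4[A] ≡ [π],
box rescaling, and `PiTimesSector` (item 26388, landed). The final part closes the ROUTE ITEM by name
(`piRationalisationSimpleBranch_proof`). Sector lemmas are REUSED from the landed rung-24903 file `…PiRationalisationSqrtMoves`.
[Kontsevich–Zagier 2001 §1.2; argument principle] Standard axioms, 0 sorry.
-/

noncomputable section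

set_option linter.dupNamespace false

namespace Summit.KontsevichZagierPeriods.RootDecompRationalCubeDichotomy.Rung27842

open Summit.KontsevichZagierPeriods.RootDecompRationalCubeDichotomy.Rung24903 (of_sub_of_mem_relations_of_fibreMap)
open MeasureTheory Set MvPolynomial
open Literature.NumberTheory.Transcendental
open Literature.NumberTheory.Transcendental.KZ
open Literature.ModelTheory.ExponentialFields (IsSemialgebraic)

/-! ### The pole contribution over a base: steps (d) + (e) of the plan for item 27842

After Green's formula on the upper half-annulus, the winding part `Im(g dz/(z − g(x)))` of `Im(z F_z/F dz)`
contributes, over a base piece `D ∋ x` (where `[D, g]` is the cube–Nash representation under study), the two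
representations
`P₁ = [D × [0, ε], 2 g(x) ε/(ε² + v²)]` (the two vertical sides `u = g(x) ± ε`, summed in the integrand) and
`P₂ = [{(x,u) | x ∈ D, g(x) − ε ≤ u ≤ g(x) + ε}, g(x) ε/((u − g(x))² + ε²)]` (the top side `v = ε`, a NASH-EDGED band).
We prove `[P₁] + [P₂] − [π]·[D, g] ∈ KZ.relations`: the fibred TRANSLATION `u ↦ u − g(x)` (one change-of-variables
move, `of_sub_of_mem_relations_of_fibreMap` with `ψs = 1`) straightens the band to `D × [−ε, ε]` and separates the
variables (`[D, g] × T`, Fubini product `KZ.of_mul_of`); `P₁` is `[D, g] × V` on the nose; then `halfWinding` and the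
commutator `[D,g]·[π] ≡ [π]·[D,g]` (`KZ.mul_sub_mul_comm_mem_relations`). -/

/-- A closed interval with rational end points, as a subset of `ℝ¹`, is `ℚ`-semialgebraic. [folklore] -/
theorem isSemialgebraic_interval (a b : ℚ) :
    IsSemialgebraic ℚ {u : Fin 1 → ℝ | (a:ℝ) ≤ u 0 ∧ u 0 ≤ (b:ℝ)} := by
  have h : {u : Fin 1 → ℝ | (a:ℝ) ≤ u 0 ∧ u 0 ≤ (b:ℝ)} =
      KZlog.band (univ : Set (Fin 0 → ℝ)) (fun _ => (a:ℝ)) (fun _ => (b:ℝ)) := by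
    ext u; simp [KZlog.mem_band]
  rw [h]
  exact KZlog.isSemialgebraic_band (isSemialgebraicFunOn_ratCast Literature.ModelTheory.ExponentialFields.isSemialgebraic_univ a)
    (isSemialgebraicFunOn_ratCast Literature.ModelTheory.ExponentialFields.isSemialgebraic_univ b)

/-- Compactness of a closed coordinate slab `{u : Fin 1 → ℝ | a ≤ u 0 ≤ b}` (as a `Set.pi` of `Icc`). [folklore] -/
theorem isCompact_slab₁ {a b : ℝ} : IsCompact {u : Fin 1 → ℝ | a ≤ u 0 ∧ u 0 ≤ b} ∧
    {u : Fin 1 → ℝ | a ≤ u 0 ∧ u 0 ≤ b} = Set.pi Set.univ (fun _ : Fin 1 => Icc a b) := by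
  have h : {u : Fin 1 → ℝ | a ≤ u 0 ∧ u 0 ≤ b} = Set.pi Set.univ (fun _ : Fin 1 => Icc a b) := by
    ext u
    simp only [mem_setOf_eq, mem_pi, mem_univ, forall_const, mem_Icc, Fin.forall_fin_one]
  refine ⟨?_, h⟩
  rw [h]
  exact isCompact_univ_pi fun _ => isCompact_Icc

/-- **The pole contribution is `[π]·[D, g]` (by the moves).** See the section docstring. Hypotheses: `g` is
`ℚ`-semialgebraic on `D` (read off `[D, g]` itself) and differentiable at the points of `D` (in the rung, `g` is
analytic near the cube). [this node; Kontsevich–Zagier 2001 §1.2 rules 1)–2), §4.1 (Fubini product)] -/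
theorem poleContribution {n : ℕ} (ε : ℚ) (hε : 0 < ε) {D : Set (Fin n → ℝ)} (g : (Fin n → ℝ) → ℝ)
    (hgd : ∀ x ∈ D, DifferentiableAt ℝ g x)
    (sg : IntegralRep n) (hsgd : sg.domain = D) (hsgi : ∀ x ∈ D, sg.integrand x = g x)
    (P₁ P₂ : IntegralRep (n + 1))
    (hP₁d : P₁.domain = KZlog.band D (fun _ => 0) (fun _ => (ε:ℝ)))
    (hP₁i : ∀ z ∈ P₁.domain,
      P₁.integrand z = 2 * g (Fin.init z) * (ε:ℝ) / ((ε:ℝ) ^ 2 + z (Fin.last n) ^ 2))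
    (hP₂d : P₂.domain = KZlog.band D (fun x => g x - ε) (fun x => g x + ε))
    (hP₂i : ∀ z ∈ P₂.domain,
      P₂.integrand z = g (Fin.init z) * (ε:ℝ) / ((z (Fin.last n) - g (Fin.init z)) ^ 2 + (ε:ℝ) ^ 2)) :
    of P₁ + of P₂ - of piRep * of sg ∈ relations := by
  have hε' : (0:ℝ) < ε := by exact_mod_cast hε
  have hg : IsSemialgebraicFunOn ℚ D g := by
    have h := sg.isSemialgebraicFunOn_integrand
    rw [hsgd] at h
    exact h.congr fun x hx => hsgi x hx
  -- the two one-dimensional representations of the half winding number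
  have hTsa : IsSemialgebraic ℚ {u : Fin 1 → ℝ | -(ε:ℝ) ≤ u 0 ∧ u 0 ≤ (ε:ℝ)} := by
    simpa [Rat.cast_neg] using isSemialgebraic_interval (-ε) ε
  have hVsa : IsSemialgebraic ℚ {u : Fin 1 → ℝ | 0 ≤ u 0 ∧ u 0 ≤ (ε:ℝ)} := by
    simpa using isSemialgebraic_interval 0 ε
  have hTf : IsSemialgebraicFunOn ℚ {u : Fin 1 → ℝ | -(ε:ℝ) ≤ u 0 ∧ u 0 ≤ (ε:ℝ)}
      (fun u => (ε:ℝ) / (u 0 ^ 2 + (ε:ℝ) ^ 2)) := by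
    refine (isSemialgebraicFunOn_aeval_div_aeval hTsa (C ε) (X 0 ^ 2 + C ε ^ 2) fun u _ => ?_).congr
      fun u _ => ?_
    · simp only [map_add, map_pow, MvPolynomial.aeval_X, MvPolynomial.aeval_C, eq_ratCast]; positivity
    · simp only [map_add, map_pow, MvPolynomial.aeval_X, MvPolynomial.aeval_C, eq_ratCast]
  have hTc : ContinuousOn (fun u : Fin 1 → ℝ => (ε:ℝ) / (u 0 ^ 2 + (ε:ℝ) ^ 2))
      {u : Fin 1 → ℝ | -(ε:ℝ) ≤ u 0 ∧ u 0 ≤ (ε:ℝ)} :=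
    (continuous_const.div (by fun_prop) fun u => by positivity).continuousOn
  let T : IntegralRep 1 := contRep _ hTsa isCompact_slab₁.1 _ hTf hTc
  have hVf : IsSemialgebraicFunOn ℚ {u : Fin 1 → ℝ | 0 ≤ u 0 ∧ u 0 ≤ (ε:ℝ)}
      (fun v => 2 * (ε:ℝ) / ((ε:ℝ) ^ 2 + v 0 ^ 2)) := by
    refine (isSemialgebraicFunOn_aeval_div_aeval hVsa (C (2:ℚ) * C ε) (C ε ^ 2 + X 0 ^ 2) fun u _ => ?_).congr
      fun u _ => ?_
    · simp only [map_add, map_pow, MvPolynomial.aeval_X, MvPolynomial.aeval_C, eq_ratCast]; positivity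
    · simp only [map_add, map_mul, map_pow, MvPolynomial.aeval_X, MvPolynomial.aeval_C, eq_ratCast,
        Rat.cast_ofNat]
  have hVc : ContinuousOn (fun v : Fin 1 → ℝ => 2 * (ε:ℝ) / ((ε:ℝ) ^ 2 + v 0 ^ 2))
      {u : Fin 1 → ℝ | 0 ≤ u 0 ∧ u 0 ≤ (ε:ℝ)} :=
    (continuous_const.div (by fun_prop) fun u => by positivity).continuousOn
  let V : IntegralRep 1 := contRep _ hVsa isCompact_slab₁.1 _ hVf hVc
  have hinit : ∀ (z : Fin (n + 1) → ℝ), (fun i : Fin n => z (Fin.castAdd 1 i)) = Fin.init z := fun z => rfl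
  -- (1) `P₁` is `[D, g] × V` on the nose
  have h1 : of P₁ - of (sg.prod V) ∈ relations := by
    refine of_sub_of_mem_relations_of_eqOn ?_ fun z hz => ?_
    · rw [IntegralRep.prod_domain, hP₁d]; ext z
      simp only [IntegralRep.mem_prodDomain, hsgd, KZlog.mem_band, hinit]
      rfl
    · have hx : Fin.init z ∈ D := by rw [hP₁d] at hz; exact hz.1
      rw [hP₁i z hz, IntegralRep.prod_integrand_eq, IntegralRep.prodFun_apply, hinit, hsgi _ hx]
      show _ = g (Fin.init z) * (2 * (ε:ℝ) / ((ε:ℝ) ^ 2 + z (Fin.natAdd n 0) ^ 2))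
      rw [show (Fin.natAdd _ (0 : Fin 1) : Fin (_ + 1)) = Fin.last _ from Fin.ext (by simp)]
      ring
  -- (2) `P₂` is `[D, g] × T` after the fibred translation `u ↦ u − g(x)`
  have h2 : of P₂ - of (sg.prod T) ∈ relations := by
    refine of_sub_of_mem_relations_of_fibreMap (m := n) (G := D) (a := fun x => g x - ε) (b := fun x => g x + ε)
      (a' := fun _ => -(ε:ℝ)) (b' := fun _ => (ε:ℝ))
      (fun z => z (Fin.last n) - g (Fin.init z)) (fun _ => 1)
      P₂ (sg.prod T) hP₂d ?_ (fun x _ => by linarith) ?_ ?_ ?_ (fun _ _ => one_pos) ?_ ?_ ?_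
    · rw [IntegralRep.prod_domain]; ext z
      simp only [IntegralRep.mem_prodDomain, hsgd, KZlog.mem_band, hinit]
      rfl
    · have hl : IsSemialgebraicFunOn ℚ P₂.domain (fun z => z (Fin.last n)) :=
        isSemialgebraicFunOn_apply P₂.isSemialgebraic_domain _
      have hgi : IsSemialgebraicFunOn ℚ P₂.domain (fun z => g (Fin.init z)) :=
        hg.comp_init_mono P₂.isSemialgebraic_domain (by rw [hP₂d]; exact KZ.band_subset_setOf_init_mem)
      exact IsSemialgebraicFunOn.sub_holds hl hgi
    · intro z hz
      have hx : Fin.init z ∈ D := by rw [hP₂d] at hz; exact hz.1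
      have hI : DifferentiableAt ℝ (fun w : Fin (n + 1) → ℝ => Fin.init w) z :=
        differentiableAt_pi.mpr fun i => differentiableAt_apply (𝕜 := ℝ) (Fin.castSucc i) z
      exact (differentiableAt_apply (𝕜 := ℝ) (Fin.last n) z).sub ((hgd _ hx).comp z hI)
    · intro z _
      simp only [Fin.snoc_last, Fin.init_snoc]
      exact (hasDerivAt_id' _).sub_const _
    · intro y _
      simp only [Fin.snoc_last, Fin.init_snoc]
      ring
    · intro y _
      simp only [Fin.snoc_last, Fin.init_snoc]
      ring
    · intro z hz
      have hx : Fin.init z ∈ D := by rw [hP₂d] at hz; exact hz.1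
      rw [hP₂i z hz, IntegralRep.prod_integrand_eq, IntegralRep.prodFun_apply, hinit, Fin.init_snoc, hsgi _ hx,
        mul_one]
      show _ = g (Fin.init z) * ((ε:ℝ) /
        ((Fin.snoc (Fin.init z) (z (Fin.last n) - g (Fin.init z)) : Fin (n + 1) → ℝ) (Fin.natAdd n 0) ^ 2 +
          (ε:ℝ) ^ 2))
      rw [show (Fin.natAdd _ (0 : Fin 1) : Fin (_ + 1)) = Fin.last _ from Fin.ext (by simp), Fin.snoc_last]
      ring
  -- (3) the half winding number and the commutator
  have hTV : of T + of V - of piRep ∈ relations := halfWinding ε hε T V rfl rfl rfl rfl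
  have h3 : of sg * (of T + of V - of piRep) ∈ relations := mul_mem_relations_left_holds _ _ hTV
  have h4 : of sg * of piRep - of piRep * of sg ∈ relations := mul_sub_mul_comm_mem_relations _ _
  have e : of P₁ + of P₂ - of piRep * of sg =
      (of P₁ - of (sg.prod V)) + (of P₂ - of (sg.prod T)) + of sg * (of T + of V - of piRep) +
        (of sg * of piRep - of piRep * of sg) := by
    rw [← of_mul_of, ← of_mul_of, mul_sub, mul_add]
    abel
  rw [e]
  exact add_mem (add_mem (add_mem h1 h2) h3) h4

/-! ### Rational boxes rescale into the unit cube (gen-4 second pass; `BoxRescale` PROVED) -/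

/-- The diagonal continuous linear map `diag(d)`. [folklore] -/
def diagCLM {m : ℕ} (d : Fin m → ℝ) : (Fin m → ℝ) →L[ℝ] (Fin m → ℝ) :=
  LinearMap.toContinuousLinearMap (Matrix.toLin' (Matrix.diagonal d))

/-- Auxiliary step `diagCLM_apply`. [bookkeeping] -/
theorem diagCLM_apply {m : ℕ} (d v : Fin m → ℝ) (j : Fin m) : diagCLM d v j = d j * v j := by
  simp only [diagCLM, LinearMap.coe_toContinuousLinearMap', Matrix.toLin'_apply, Matrix.mulVec_diagonal]

/-- Auxiliary step `det_diagCLM`. [bookkeeping] -/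
theorem det_diagCLM {m : ℕ} (d : Fin m → ℝ) : (diagCLM d).det = ∏ j, d j := by
  simp [diagCLM, LinearMap.det_toLin', Matrix.det_diagonal]

/-- The affine box map `t ↦ lo + d·t` (coordinatewise). [folklore] -/
def boxMap {m : ℕ} (lo d : Fin m → ℝ) (t : Fin m → ℝ) : Fin m → ℝ := fun j => lo j + d j * t j

/-- Auxiliary step `boxMap_eq`. [bookkeeping] -/
theorem boxMap_eq {m : ℕ} (lo d : Fin m → ℝ) : boxMap lo d = fun t => lo + diagCLM d t := by
  funext t; ext j; simp [boxMap, diagCLM_apply]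

/-- Auxiliary step `hasFDerivWithinAt_boxMap`. [bookkeeping] -/
theorem hasFDerivWithinAt_boxMap {m : ℕ} (lo d : Fin m → ℝ) (s : Set (Fin m → ℝ)) (t : Fin m → ℝ) :
    HasFDerivWithinAt (boxMap lo d) (diagCLM d) s t := by
  rw [boxMap_eq]
  exact ((diagCLM d).hasFDerivWithinAt).const_add lo

/-- Auxiliary step `injOn_boxMap`. [bookkeeping] -/
theorem injOn_boxMap {m : ℕ} (lo d : Fin m → ℝ) (hd : ∀ j, d j ≠ 0) (s : Set (Fin m → ℝ)) :
    InjOn (boxMap lo d) s := by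
  intro t _ t' _ h
  ext j
  have hj := congr_fun h j
  simp only [boxMap, add_right_inj] at hj
  exact mul_left_cancel₀ (hd j) hj

/-- Auxiliary step `image_boxMap_cube`. [bookkeeping] -/
theorem image_boxMap_cube {m : ℕ} (lo d : Fin m → ℝ) (hd : ∀ j, 0 < d j) :
    boxMap lo d '' Set.pi Set.univ (fun _ : Fin m => Set.Icc (0:ℝ) 1) =
      Set.pi Set.univ (fun j : Fin m => Set.Icc (lo j) (lo j + d j)) := by
  ext z
  simp only [Set.mem_image, Set.mem_pi, Set.mem_univ, forall_const, Set.mem_Icc]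
  constructor
  · rintro ⟨t, ht, rfl⟩ j
    have h0 := (ht j).1
    have h1 := (ht j).2
    have hdj := hd j
    refine ⟨?_, ?_⟩
    · simp only [boxMap]; nlinarith
    · simp only [boxMap]; nlinarith
  · intro hz
    refine ⟨fun j => (z j - lo j) / d j, fun j => ⟨?_, ?_⟩, ?_⟩
    · exact div_nonneg (by linarith [(hz j).1]) (hd j).le
    · rw [div_le_one (hd j)]; linarith [(hz j).2]
    · funext j
      have hdj : d j ≠ 0 := (hd j).ne'
      simp only [boxMap]
      field_simp
      ring

/-- The box map with rational data is a polynomial map over `ℚ`, hence `ℚ`-semialgebraic. [BCR 1998, §2.2] -/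
theorem isSemialgebraicMapOn_boxMap {m : ℕ} (lo d : Fin m → ℚ) {s : Set (Fin m → ℝ)} (hs : IsSemialgebraic ℚ s) :
    IsSemialgebraicMapOn ℚ s (boxMap (fun j => (lo j : ℝ)) (fun j => (d j : ℝ))) := by
  refine (isSemialgebraicMapOn_aeval (R := ℝ) hs fun j : Fin m =>
    (C (lo j) + C (d j) * X j : MvPolynomial (Fin m) ℚ)).congr fun x _ => ?_
  ext j
  simp [boxMap, eq_ratCast]

/-- The substituted polynomial: `bind₁ (j ↦ loⱼ + dⱼ Xⱼ)`. -/
def boxSubst {m : ℕ} (lo d : Fin m → ℚ) (P : MvPolynomial (Fin m) ℚ) : MvPolynomial (Fin m) ℚ :=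
  bind₁ (fun j : Fin m => (C (lo j) + C (d j) * X j : MvPolynomial (Fin m) ℚ)) P

/-- Auxiliary step `aeval_boxSubst`. [bookkeeping] -/
theorem aeval_boxSubst {m : ℕ} (lo d : Fin m → ℚ) (P : MvPolynomial (Fin m) ℚ) (t : Fin m → ℝ) :
    aeval t (boxSubst lo d P) = aeval (boxMap (fun j => (lo j : ℝ)) (fun j => (d j : ℝ)) t) P := by
  have h : (fun j => aeval t (C (lo j) + C (d j) * X j : MvPolynomial (Fin m) ℚ)) =
      boxMap (fun j => (lo j : ℝ)) (fun j => (d j : ℝ)) t := by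
    funext j
    simp [boxMap, eq_ratCast]
  rw [boxSubst, aeval_bind₁, h]

/-- Auxiliary step `cubeLit_eq_cube'`. [bookkeeping] -/
theorem cubeLit_eq_cube' (m : ℕ) : Set.pi Set.univ (fun _ : Fin m => Set.Icc (0:ℝ) 1) = KZ.cube m :=
  (KZ.cube_eq_pi m).symm

/-- **Rational boxes rescale into the unit cube** (one change-of-variables move). For a representation `q` on
the rational box `Π[loᵢ, hiᵢ]` with integrand `P/Q` (`Q` zero-free on the box) there is a representation `q'`
on the closed unit cube with integrand `P̃/Q̃`, `Q̃` zero-free on the cube, and `[q'] − [q] ∈ relations`.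
[Kontsevich–Zagier 2001, §1.2, rule 2)] -/
theorem exists_cube_of_ratBox {m : ℕ} (q : IntegralRep m) (lo hi : Fin m → ℚ) (P Q : MvPolynomial (Fin m) ℚ)
    (hlohi : ∀ i, lo i < hi i)
    (hdom : q.domain = Set.pi Set.univ (fun i : Fin m => Set.Icc ((lo i : ℚ) : ℝ) (hi i)))
    (hQ : ∀ z ∈ q.domain, aeval z Q ≠ 0) (hint : ∀ z ∈ q.domain, q.integrand z = aeval z P / aeval z Q) :
    ∃ (q' : IntegralRep m) (P' Q' : MvPolynomial (Fin m) ℚ),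
      q'.domain = Set.pi Set.univ (fun _ : Fin m => Set.Icc (0:ℝ) 1) ∧
      (∀ z ∈ Set.pi Set.univ (fun _ : Fin m => Set.Icc (0:ℝ) 1), aeval z Q' ≠ 0) ∧
      (∀ z ∈ Set.pi Set.univ (fun _ : Fin m => Set.Icc (0:ℝ) 1), q'.integrand z = aeval z P' / aeval z Q') ∧
      of q' - of q ∈ relations := by
  classical
  -- data
  set d : Fin m → ℚ := fun j => hi j - lo j with hd
  have hdpos : ∀ j, (0:ℝ) < (d j : ℝ) := fun j => by
    have := hlohi j; rw [hd]; exact_mod_cast sub_pos.2 this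
  set Φ : (Fin m → ℝ) → (Fin m → ℝ) := boxMap (fun j => (lo j : ℝ)) (fun j => (d j : ℝ)) with hΦ
  set C0 : Set (Fin m → ℝ) := Set.pi Set.univ (fun _ : Fin m => Set.Icc (0:ℝ) 1) with hC0
  have hC0sa : IsSemialgebraic ℚ C0 := by rw [hC0, cubeLit_eq_cube']; exact KZ.isSemialgebraic_cube
  have hC0c : IsCompact C0 := isCompact_univ_pi fun _ => isCompact_Icc
  -- the image of the cube is the box
  have himage : Φ '' C0 = q.domain := by
    rw [hΦ, hC0, image_boxMap_cube _ _ hdpos, hdom]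
    congr 1; funext j
    rw [hd]; push_cast; congr 1; ring
  have hmaps : ∀ t ∈ C0, Φ t ∈ q.domain := fun t ht => himage ▸ Set.mem_image_of_mem Φ ht
  -- the new polynomials
  set Q' : MvPolynomial (Fin m) ℚ := boxSubst lo d Q with hQ'
  set P' : MvPolynomial (Fin m) ℚ := C (∏ j, d j) * boxSubst lo d P with hP'
  have hQ'eval : ∀ t, aeval t Q' = aeval (Φ t) Q := fun t => by rw [hQ', aeval_boxSubst]
  have hP'eval : ∀ t, aeval t P' = ((∏ j, d j : ℚ) : ℝ) * aeval (Φ t) P := fun t => by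
    rw [hP', map_mul, aeval_C, aeval_boxSubst, eq_ratCast]
  have hQ'ne : ∀ t ∈ C0, aeval t Q' ≠ 0 := fun t ht => by rw [hQ'eval]; exact hQ _ (hmaps t ht)
  -- the new integrand
  set f' : (Fin m → ℝ) → ℝ := fun t => aeval t P' / aeval t Q' with hf'
  have hf'sa : IsSemialgebraicFunOn ℚ C0 f' := isSemialgebraicFunOn_aeval_div_aeval hC0sa P' Q' hQ'ne
  have hf'c : ContinuousOn f' C0 := by
    refine ContinuousOn.div (Literature.ModelTheory.ExponentialFields.continuous_aeval_real P').continuousOn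
      (Literature.ModelTheory.ExponentialFields.continuous_aeval_real Q').continuousOn hQ'ne
  let q' : IntegralRep m := contRep C0 hC0sa hC0c f' hf'sa hf'c
  -- the Jacobian
  have hdet : |(diagCLM (fun j => (d j : ℝ))).det| = ((∏ j, d j : ℚ) : ℝ) := by
    rw [det_diagCLM, abs_of_pos (Finset.prod_pos fun j _ => hdpos j)]
    push_cast; rfl
  refine ⟨q', P', Q', rfl, hQ'ne, fun z _ => rfl, ?_⟩
  refine changeOfVariablesRel_subset_relations
    ⟨m, q', q, Φ, fun _ => diagCLM (fun j => (d j : ℝ)), ?_, fun t _ => ?_, ?_, himage.symm, fun t ht => ?_, rfl⟩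
  · exact isSemialgebraicMapOn_boxMap lo d hC0sa
  · exact hasFDerivWithinAt_boxMap _ _ _ _
  · exact injOn_boxMap _ _ (fun j => (hdpos j).ne') _
  · -- integrand identity: f' t = (P/Q)(Φ t) * |det|
    show f' t = q.integrand (Φ t) * _
    rw [hdet, hint _ (hmaps t ht), hf']
    simp only
    rw [hP'eval, hQ'eval]
    ring

end Summit.KontsevichZagierPeriods.RootDecompRationalCubeDichotomy.Rung27842

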